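import Mathlib
import HarnessLib
import Summits.NavierStokesRegularity.NavierStokesRegularity.Theorems.PoloidalWindowDoorPoloidalWindowRigidityHorizontalMean
import Summits.NavierStokesRegularity.NavierStokesRegularity.Theorems.PoloidalWindowDoorPoloidalWindowRigidityClebschVorticity
import Literature.Analysis.FluidPDE.FirstIntegralTransportDefect

/-!
# Route `PoloidalWindowDoor`, crux `PoloidalWindowRigidity` (stmt-19708), line `sparse_energy`, rung R2 —
# the plane mean of the (TH) scalar law: the pressure datum against plane means (one time slice)

Seat ns-poloidal-K2-p2 g8 (interim LEAD-of-record on 19708; file `--supports`; brick 2 of rung R2 «plane means ⇒ `A ≡ 0`»).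
ONE TIME SLICE, pure calculus.  Let `w : ℝ³ → ℝ³` be `C²`, divergence free, with `‖w‖ ≤ M₀`, `‖Dw‖ ≤ M₁`, let `wt : ℝ³ → ℝ` be
continuous (it will be `∂ₜv₂(s,·)`), and suppose the (TH) scalar law holds ON THE WHOLE PLANE `{x₂ = ζ}` with slope numbers
`m₀ = μ(s,ζ)`, `mₜ = ∂ₜμ`, `m_z = ∂_zμ`, `m_zz = ∂_z²μ` and pressure datum `a = A(s,ζ)` (this is what `…TwistingTHSlab.eLaw_on_of_germ`
delivers for a class profile):
`(1−m₀)(wt + Dw₂·w − Δw₂) = a + (mₜ − m_zz) w₂ + (m_z/2) w₂² − 2 m_z ∂₂w₂`.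
Taking the horizontal bump mean `⟨·⟩ = hmean φ c R z` over that plane (`…HorizontalMean`), every term except `⟨wt⟩` is small when
the plane means of `|w|²` are small (`≤ δ²`) and `R` is large:

  `|a − (1−m₀)⟨wt⟩| ≤ |1−m₀|(3M₁δ + 2R⁻¹M₁B_φ) + (|mₜ|+|m_zz|)δ + |m_z|δ²/2 + 2|m_z|R⁻¹M₀B_φ`   (`abs_pressureDatum_sub_le`),

`B_φ = ‖∂₀φ̄‖₁ + ‖∂₁φ̄‖₁`.  Ingredients: `⟨w_k∂_kw₂⟩ ≤ M₁⟨|w_k|⟩ ≤ M₁δ` (Jensen, `hmean_variance_nonneg`); horizontal second derivatives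
and `∂₂w₂ = −∂₀w₀ − ∂₁w₁`, `∂₂²w₂ = −∂₀(∂₂w₀) − ∂₁(∂₂w₁)` (incompressibility + symmetry of second derivatives) are horizontal
derivatives of bounded functions, hence `O(1/R)` in the mean (`abs_hmean_fderiv_horizontal_le`).

WHAT THIS IS NOT: not a claim about Navier–Stokes regularity — slice calculus for rung R2 of ONE line (bears_on LADDER-NS N0 via crux 19708).
-/

noncomputable section

-- the summit and its single sub-problem share the name (CONVENTIONS §1), as in every Theorems file
set_option linter.dupNamespace false

namespace Summit.NavierStokesRegularity.NavierStokesRegularity.Theorems.PoloidalWindowDoorPoloidalWindowRigiditySparseEnergyPlaneLaw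

open MeasureTheory Set Function Filter Topology Metric
open scoped RealInnerProductSpace InnerProductSpace Laplacian
open Literature.Analysis Literature.Analysis.FluidPDE
open Summit.NavierStokesRegularity.NavierStokesRegularity.Theorems.PoloidalWindowDoorPoloidalWindowRigidityHorizontalMean
open Summit.NavierStokesRegularity.NavierStokesRegularity.Theorems.PoloidalWindowDoorPoloidalWindowRigidityClebschVorticity

variable {w : EuclideanSpace ℝ (Fin 3) → EuclideanSpace ℝ (Fin 3)}

/-! ### Slice calculus for a `C²` vector field -/

/-- Components commute with `fderiv`: `D(w·ᵢ)(x) e = (Dw(x) e)ᵢ`. [folklore] -/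
theorem fderiv_apply_comp (hw : Differentiable ℝ w) (i : Fin 3) (x e : EuclideanSpace ℝ (Fin 3)) :
    fderiv ℝ (fun y => w y i) x e = fderiv ℝ w x e i := by
  have h : (fun y => w y i) = (EuclideanSpace.proj i : EuclideanSpace ℝ (Fin 3) →L[ℝ] ℝ) ∘ w := rfl
  rw [h, fderiv_comp x (EuclideanSpace.proj i).differentiableAt (hw x), ContinuousLinearMap.fderiv]
  rfl

/-- The first-derivative slices `y ↦ (Dw(y) e)ᵢ` of a `C²` field are `C¹`. [folklore] -/
theorem contDiff_fderiv_apply (hw : ContDiff ℝ 2 w) (e : EuclideanSpace ℝ (Fin 3)) (i : Fin 3) :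
    ContDiff ℝ 1 fun y => fderiv ℝ w y e i := by
  have h1 : ContDiff ℝ 1 fun y => fderiv ℝ w y e :=
    (hw.fderiv_right (m := 1) (by norm_num)).clm_apply contDiff_const
  exact (EuclideanSpace.proj i : EuclideanSpace ℝ (Fin 3) →L[ℝ] ℝ).contDiff.comp h1

/-- The convective derivative of `w₂` in coordinates: `Dw₂(x)·w(x) = Σₖ wₖ ∂ₖw₂`. [folklore] -/
theorem convect_two_eq (hw : Differentiable ℝ w) (x : EuclideanSpace ℝ (Fin 3)) :
    fderiv ℝ (fun y => w y 2) x (w x) = ∑ k : Fin 3, w x k * fderiv ℝ w x (EuclideanSpace.single k 1) 2 := by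
  rw [clf_apply_eq_sum3]
  refine Finset.sum_congr rfl fun k _ => ?_
  rw [fderiv_apply_comp hw]

/-- The Laplacian of `w₂` in coordinates: `Δw₂ = Σₖ ∂ₖ(∂ₖw₂)`. [folklore] -/
theorem laplacian_two_eq (hw : ContDiff ℝ 2 w) (x : EuclideanSpace ℝ (Fin 3)) :
    (Δ (fun y => w y 2)) x =
      ∑ k : Fin 3, fderiv ℝ (fun y => fderiv ℝ w y (EuclideanSpace.single k 1) 2) x (EuclideanSpace.single k 1) := by
  have hwd : Differentiable ℝ w := hw.differentiable (by norm_num)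
  have hw2 : ContDiff ℝ 2 fun y => w y 2 := (EuclideanSpace.proj (2 : Fin 3) : EuclideanSpace ℝ (Fin 3) →L[ℝ] ℝ).contDiff.comp hw
  rw [Literature.Analysis.FluidPDE.laplacian_eq_sum_fderiv_fderiv_curried (EuclideanSpace.basisFun (Fin 3) ℝ)]
  refine Finset.sum_congr rfl fun k _ => ?_
  have hd : DifferentiableAt ℝ (fderiv ℝ (fun y => w y 2)) x :=
    (hw2.fderiv_right (m := 1) (by norm_num)).differentiable (by norm_num) x
  rw [EuclideanSpace.basisFun_apply]
  symm
  have hfun : (fun y => fderiv ℝ w y (EuclideanSpace.single k 1) 2) =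
      fun y => (fderiv ℝ (fun y' => w y' 2) y) (EuclideanSpace.single k 1) := by
    funext y; rw [fderiv_apply_comp hwd]
  rw [hfun, fderiv_clm_apply hd (differentiableAt_const _)]
  simp

/-- Incompressibility differentiated vertically, with the mixed derivatives swapped (symmetry of second derivatives):
`∂₂(∂₂w₂) = −∂₀(∂₂w₀) − ∂₁(∂₂w₁)`. [folklore] -/
theorem fderiv_vert_vert_eq (hw : ContDiff ℝ 2 w)
    (hdiv : ∀ x, fderiv ℝ w x (EuclideanSpace.single 0 1) 0 + fderiv ℝ w x (EuclideanSpace.single 1 1) 1 +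
      fderiv ℝ w x (EuclideanSpace.single 2 1) 2 = 0) (x : EuclideanSpace ℝ (Fin 3)) :
    fderiv ℝ (fun y => fderiv ℝ w y (EuclideanSpace.single 2 1) 2) x (EuclideanSpace.single 2 1) =
      -(fderiv ℝ (fun y => fderiv ℝ w y (EuclideanSpace.single 2 1) 0) x (EuclideanSpace.single 0 1)) -
        fderiv ℝ (fun y => fderiv ℝ w y (EuclideanSpace.single 2 1) 1) x (EuclideanSpace.single 1 1) := by
  have hwd : Differentiable ℝ w := hw.differentiable (by norm_num)
  -- symmetry of mixed second derivatives of the scalar components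
  have hsymm : ∀ (i : Fin 3) (u u' : EuclideanSpace ℝ (Fin 3)),
      fderiv ℝ (fun y => fderiv ℝ w y u i) x u' = fderiv ℝ (fun y => fderiv ℝ w y u' i) x u := by
    intro i u u'
    have hci : ContDiff ℝ 2 fun y => w y i := (EuclideanSpace.proj i : EuclideanSpace ℝ (Fin 3) →L[ℝ] ℝ).contDiff.comp hw
    have hfun : ∀ u₀ : EuclideanSpace ℝ (Fin 3), (fun y => fderiv ℝ w y u₀ i) = fun y => fderiv ℝ (fun y' => w y' i) y u₀ := by
      intro u₀; funext y; rw [fderiv_apply_comp hwd]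
    have hd : DifferentiableAt ℝ (fderiv ℝ fun y' => w y' i) x :=
      (hci.fderiv_right (m := 1) (by norm_num)).differentiable (by norm_num) x
    rw [hfun u, hfun u', fderiv_clm_apply hd (differentiableAt_const _), fderiv_clm_apply hd (differentiableAt_const _)]
    simp only [fderiv_fun_const, Pi.zero_apply, ContinuousLinearMap.comp_zero, zero_add, ContinuousLinearMap.flip_apply]
    exact (hci.contDiffAt.isSymmSndFDerivAt (by simp)).eq u' u
  -- differentiate `∂₂w₂ = −∂₀w₀ − ∂₁w₁` in the direction `e₂`
  have hfun : (fun y => fderiv ℝ w y (EuclideanSpace.single 2 1) 2) =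
      fun y => -(fderiv ℝ w y (EuclideanSpace.single 0 1) 0) - fderiv ℝ w y (EuclideanSpace.single 1 1) 1 := by
    funext y; linarith [hdiv y]
  have hd0 : DifferentiableAt ℝ (fun y => fderiv ℝ w y (EuclideanSpace.single 0 1) 0) x :=
    (contDiff_fderiv_apply hw _ 0).differentiable one_ne_zero x
  have hd1 : DifferentiableAt ℝ (fun y => fderiv ℝ w y (EuclideanSpace.single 1 1) 1) x :=
    (contDiff_fderiv_apply hw _ 1).differentiable one_ne_zero x
  have hD : HasFDerivAt (fun y => -(fderiv ℝ w y (EuclideanSpace.single 0 1) 0) - fderiv ℝ w y (EuclideanSpace.single 1 1) 1)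
      (-(fderiv ℝ (fun y => fderiv ℝ w y (EuclideanSpace.single 0 1) 0) x) -
        fderiv ℝ (fun y => fderiv ℝ w y (EuclideanSpace.single 1 1) 1) x) x :=
    (hd0.hasFDerivAt.neg).sub hd1.hasFDerivAt
  rw [hfun, hD.fderiv, FunLike.coe_sub, FunLike.coe_neg, Pi.sub_apply, Pi.neg_apply,
    hsymm 0 (EuclideanSpace.single 0 1) (EuclideanSpace.single 2 1), hsymm 1 (EuclideanSpace.single 1 1) (EuclideanSpace.single 2 1)]

/-! ### Two mean inequalities -/

variable (φ : ContDiffBump (0 : EuclideanSpace ℝ (Fin 2))) (c : EuclideanSpace ℝ (Fin 3)) (R z : ℝ)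

/-- `|⟨G·F⟩| ≤ M⟨|G|⟩` for continuous `F, G` with `|F| ≤ M`. [folklore] -/
theorem abs_hmean_mul_le {F G : EuclideanSpace ℝ (Fin 3) → ℝ} (hF : Continuous F) (hG : Continuous G) {M : ℝ}
    (hM : ∀ x, |F x| ≤ M) : |hmean φ c R z (fun x => G x * F x)| ≤ M * hmean φ c R z (fun x => |G x|) := by
  have hM0 : 0 ≤ M := le_trans (abs_nonneg _) (hM 0)
  have hpt : ∀ x, |G x * F x| ≤ M * |G x| := fun x => by
    rw [abs_mul, mul_comm]; exact mul_le_mul_of_nonneg_right (hM x) (abs_nonneg _)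
  rw [← hmean_const_mul, abs_le]
  constructor
  · have hc1 : Continuous fun x => -(M * |G x|) := (continuous_const.mul hG.abs).neg
    have hc2 : Continuous fun x => G x * F x := hG.mul hF
    have h := hmean_mono φ c R z hc1 hc2 fun x => (abs_le.1 (hpt x)).1
    have e : hmean φ c R z (fun x => -(M * |G x|)) = -hmean φ c R z (fun x => M * |G x|) := by
      simp [hmean, neg_mul, integral_neg]
    linarith [e ▸ h]
  · have hc1 : Continuous fun x => M * |G x| := continuous_const.mul hG.abs
    have hc2 : Continuous fun x => G x * F x := hG.mul hF
    exact hmean_mono φ c R z hc2 hc1 fun x => (abs_le.1 (hpt x)).2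

/-- **Jensen for a component**: if `⟨|w|²⟩ ≤ δ²` then `⟨|w_k|⟩ ≤ δ`. [folklore] -/
theorem hmean_abs_apply_le (hw : Continuous w) (k : Fin 3) {δ : ℝ} (hδ : 0 ≤ δ)
    (h : hmean φ c R z (fun x => ‖w x‖ ^ 2) ≤ δ ^ 2) : hmean φ c R z (fun x => |w x k|) ≤ δ := by
  have hk : Continuous fun x => |w x k| := ((EuclideanSpace.proj k).continuous.comp hw).abs
  have hvar := hmean_variance_nonneg φ c R z hk
  have hsq : hmean φ c R z (fun x => |w x k| ^ 2) ≤ hmean φ c R z (fun x => ‖w x‖ ^ 2) :=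
    hmean_mono φ c R z (hk.pow 2) ((hw.norm).pow 2) fun x => by
      rw [sq_abs, EuclideanSpace.real_norm_sq_eq]
      exact Finset.single_le_sum (f := fun i => w x i ^ 2) (fun i _ => sq_nonneg _) (Finset.mem_univ k)
  have h0 : 0 ≤ hmean φ c R z (fun x => |w x k|) := hmean_nonneg φ c R z fun x => abs_nonneg _
  exact (pow_le_pow_iff_left₀ h0 hδ two_ne_zero).1 (by linarith)


/-! ### The pressure datum against plane means -/

/-- **The plane mean of the (TH) scalar law.**  If the law holds on the whole plane `{x₂ = ζ}` with slope numbers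
`m₀, mₜ, m_z, m_zz` and datum `a`, then for every bump mean over that plane (`c₂ + z = ζ`, scale `R > 0`) and every `δ ≥ 0`
bounding the plane means of `|w|²` at scale `R`:
`|a − (1−m₀)⟨wt⟩| ≤ |1−m₀|(3M₁δ + 2R⁻¹M₁B) + (|mₜ|+|m_zz|)δ + |m_z|/2·δ² + 2|m_z|R⁻¹M₀B`, `B = ‖∂₀φ̄‖₁ + ‖∂₁φ̄‖₁`. [folklore] -/
theorem abs_pressureDatum_sub_le (hw : ContDiff ℝ 2 w) {M₀ M₁ : ℝ}
    (h0 : ∀ x, ‖w x‖ ≤ M₀) (h1 : ∀ x, ‖fderiv ℝ w x‖ ≤ M₁)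
    (hdiv : ∀ x, fderiv ℝ w x (EuclideanSpace.single 0 1) 0 + fderiv ℝ w x (EuclideanSpace.single 1 1) 1 +
      fderiv ℝ w x (EuclideanSpace.single 2 1) 2 = 0)
    {wt : EuclideanSpace ℝ (Fin 3) → ℝ} (hwt : Continuous wt) {ζ m₀ mt mz mzz a : ℝ}
    (hE : ∀ x : EuclideanSpace ℝ (Fin 3), x 2 = ζ →
      (1 - m₀) * (wt x + fderiv ℝ (fun y => w y 2) x (w x) - Δ (fun y => w y 2) x) =
        a + (mt - mzz) * w x 2 + mz / 2 * w x 2 ^ 2 - 2 * mz * fderiv ℝ w x (EuclideanSpace.single 2 1) 2)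
    (hR : 0 < R) (hcz : c 2 + z = ζ) {δ : ℝ} (hδ0 : 0 ≤ δ)
    (hδ : hmean φ c R z (fun x => ‖w x‖ ^ 2) ≤ δ ^ 2) :
    |a - (1 - m₀) * hmean φ c R z wt| ≤
      |1 - m₀| * (3 * M₁ * δ + 2 * (R⁻¹ * M₁ * (bumpDerivNorm φ 0 + bumpDerivNorm φ 1))) + (|mt| + |mzz|) * δ
        + |mz| / 2 * δ ^ 2 + 2 * |mz| * (R⁻¹ * M₀ * (bumpDerivNorm φ 0 + bumpDerivNorm φ 1)) := by
  have hwd : Differentiable ℝ w := hw.differentiable (by norm_num)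
  have hwc : Continuous w := hwd.continuous
  have hM₀ : 0 ≤ M₀ := le_trans (norm_nonneg _) (h0 0)
  have hM₁ : 0 ≤ M₁ := le_trans (norm_nonneg _) (h1 0)
  set β : ℝ := bumpDerivNorm φ 0 + bumpDerivNorm φ 1 with hβ
  have hβ0 : 0 ≤ bumpDerivNorm φ 0 := bumpDerivNorm_nonneg φ 0
  have hβ1 : 0 ≤ bumpDerivNorm φ 1 := bumpDerivNorm_nonneg φ 1
  -- first derivatives `∂ₖw₂` and their bounds
  have hDc : ∀ (e : EuclideanSpace ℝ (Fin 3)) (i : Fin 3), Continuous fun x => fderiv ℝ w x e i :=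
    fun e i => (contDiff_fderiv_apply hw e i).continuous
  have hDb : ∀ (k i : Fin 3) (x : EuclideanSpace ℝ (Fin 3)), |fderiv ℝ w x (EuclideanSpace.single k 1) i| ≤ M₁ := by
    intro k i x
    have hs : ‖(EuclideanSpace.single k (1 : ℝ) : EuclideanSpace ℝ (Fin 3))‖ = 1 := by simp
    calc |fderiv ℝ w x (EuclideanSpace.single k 1) i| ≤ ‖fderiv ℝ w x (EuclideanSpace.single k 1)‖ := by
          simpa using PiLp.norm_apply_le (fderiv ℝ w x (EuclideanSpace.single k 1)) i
      _ ≤ ‖fderiv ℝ w x‖ * ‖(EuclideanSpace.single k (1 : ℝ) : EuclideanSpace ℝ (Fin 3))‖ := ContinuousLinearMap.le_opNorm _ _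
      _ ≤ M₁ := by rw [hs, mul_one]; exact h1 x
  have hwb : ∀ (i : Fin 3) (x : EuclideanSpace ℝ (Fin 3)), |w x i| ≤ M₀ := fun i x =>
    le_trans (by simpa using PiLp.norm_apply_le (w x) i) (h0 x)
  -- second derivatives are continuous
  have hD2c : ∀ (e e' : EuclideanSpace ℝ (Fin 3)) (i : Fin 3),
      Continuous fun x => fderiv ℝ (fun y => fderiv ℝ w y e i) x e' := fun e e' i =>
    ((contDiff_fderiv_apply hw e i).continuous_fderiv one_ne_zero).clm_apply continuous_const
  -- the pieces of the law, as continuous functions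
  set Cv : EuclideanSpace ℝ (Fin 3) → ℝ := fun x =>
    w x 0 * fderiv ℝ w x (EuclideanSpace.single 0 1) 2 + w x 1 * fderiv ℝ w x (EuclideanSpace.single 1 1) 2 +
      w x 2 * fderiv ℝ w x (EuclideanSpace.single 2 1) 2 with hCv
  set Lp : EuclideanSpace ℝ (Fin 3) → ℝ := fun x =>
    fderiv ℝ (fun y => fderiv ℝ w y (EuclideanSpace.single 0 1) 2) x (EuclideanSpace.single 0 1) +
      fderiv ℝ (fun y => fderiv ℝ w y (EuclideanSpace.single 1 1) 2) x (EuclideanSpace.single 1 1) +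
      fderiv ℝ (fun y => fderiv ℝ w y (EuclideanSpace.single 2 1) 2) x (EuclideanSpace.single 2 1) with hLp
  have hwi : ∀ i : Fin 3, Continuous fun x => w x i := fun i => (EuclideanSpace.proj i).continuous.comp hwc
  have hCvc : Continuous Cv := (((hwi 0).mul (hDc _ 2)).add ((hwi 1).mul (hDc _ 2))).add ((hwi 2).mul (hDc _ 2))
  have hLpc : Continuous Lp := ((hD2c _ _ 2).add (hD2c _ _ 2)).add (hD2c _ _ 2)
  -- the law, pointwise on the plane, solved for `a`
  set Rest : EuclideanSpace ℝ (Fin 3) → ℝ := fun x =>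
    (1 - m₀) * Cv x - (1 - m₀) * Lp x - (mt - mzz) * w x 2 - mz / 2 * w x 2 ^ 2 +
      2 * mz * fderiv ℝ w x (EuclideanSpace.single 2 1) 2 with hRest
  have hRc : Continuous Rest :=
    ((((continuous_const.mul hCvc).sub (continuous_const.mul hLpc)).sub (continuous_const.mul (hwi 2))).sub
      (continuous_const.mul ((hwi 2).pow 2))).add (continuous_const.mul (hDc _ 2))
  have hplane : ∀ y : EuclideanSpace ℝ (Fin 2), (1 - m₀) * wt (pt c R z y) + Rest (pt c R z y) = a := by
    intro y
    have hx : (pt c R z y) 2 = ζ := by rw [pt_apply_two, hcz]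
    have h := hE _ hx
    rw [convect_two_eq hwd, laplacian_two_eq hw, Fin.sum_univ_three, Fin.sum_univ_three] at h
    rw [hRest, hCv, hLp]
    linear_combination h
  have hmeanG : hmean φ c R z (fun x => (1 - m₀) * wt x + Rest x) = a := hmean_eq_of_forall_eq φ c R z hplane
  have hc_wt : Continuous fun x => (1 - m₀) * wt x := continuous_const.mul hwt
  have hsplit : a - (1 - m₀) * hmean φ c R z wt = hmean φ c R z Rest := by
    rw [← hmeanG, hmean_add φ c R z (F := fun x => (1 - m₀) * wt x) (G := Rest) hc_wt hRc, hmean_const_mul]; ring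
  -- the mean of `Rest`, term by term
  have hc_w2 : Continuous fun x => w x 2 := hwi 2
  have hc_w2sq : Continuous fun x => w x 2 ^ 2 := (hwi 2).pow 2
  have hc_D2 : Continuous fun x => fderiv ℝ w x (EuclideanSpace.single 2 1) 2 := hDc _ 2
  have hc_t1 : Continuous fun x => (1 - m₀) * Cv x := continuous_const.mul hCvc
  have hc_t2 : Continuous fun x => (1 - m₀) * Lp x := continuous_const.mul hLpc
  have hc_t3 : Continuous fun x => (mt - mzz) * w x 2 := continuous_const.mul hc_w2
  have hc_t4 : Continuous fun x => mz / 2 * w x 2 ^ 2 := continuous_const.mul hc_w2sq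
  have hc_t5 : Continuous fun x => 2 * mz * fderiv ℝ w x (EuclideanSpace.single 2 1) 2 := continuous_const.mul hc_D2
  have hc_s12 : Continuous fun x => (1 - m₀) * Cv x - (1 - m₀) * Lp x := hc_t1.sub hc_t2
  have hc_s123 : Continuous fun x => (1 - m₀) * Cv x - (1 - m₀) * Lp x - (mt - mzz) * w x 2 := hc_s12.sub hc_t3
  have hc_s1234 : Continuous fun x => (1 - m₀) * Cv x - (1 - m₀) * Lp x - (mt - mzz) * w x 2 - mz / 2 * w x 2 ^ 2 :=
    hc_s123.sub hc_t4
  have hRest_mean : hmean φ c R z Rest =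
      (1 - m₀) * hmean φ c R z Cv - (1 - m₀) * hmean φ c R z Lp - (mt - mzz) * hmean φ c R z (fun x => w x 2)
        - mz / 2 * hmean φ c R z (fun x => w x 2 ^ 2) + 2 * mz * hmean φ c R z (fun x => fderiv ℝ w x (EuclideanSpace.single 2 1) 2) := by
    rw [hRest, hmean_add φ c R z (F := fun x => (1 - m₀) * Cv x - (1 - m₀) * Lp x - (mt - mzz) * w x 2 - mz / 2 * w x 2 ^ 2)
        (G := fun x => 2 * mz * fderiv ℝ w x (EuclideanSpace.single 2 1) 2) hc_s1234 hc_t5,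
      hmean_sub φ c R z (F := fun x => (1 - m₀) * Cv x - (1 - m₀) * Lp x - (mt - mzz) * w x 2)
        (G := fun x => mz / 2 * w x 2 ^ 2) hc_s123 hc_t4,
      hmean_sub φ c R z (F := fun x => (1 - m₀) * Cv x - (1 - m₀) * Lp x) (G := fun x => (mt - mzz) * w x 2) hc_s12 hc_t3,
      hmean_sub φ c R z (F := fun x => (1 - m₀) * Cv x) (G := fun x => (1 - m₀) * Lp x) hc_t1 hc_t2,
      hmean_const_mul, hmean_const_mul, hmean_const_mul, hmean_const_mul, hmean_const_mul]
  -- (1) the convective mean: `|⟨Cv⟩| ≤ 3 M₁ δ`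
  have hk : ∀ k : Fin 3, |hmean φ c R z (fun x => w x k * fderiv ℝ w x (EuclideanSpace.single k 1) 2)| ≤ M₁ * δ := by
    intro k
    calc |hmean φ c R z (fun x => w x k * fderiv ℝ w x (EuclideanSpace.single k 1) 2)|
        ≤ M₁ * hmean φ c R z (fun x => |w x k|) := abs_hmean_mul_le φ c R z (hDc _ 2) (hwi k) (hDb k 2)
      _ ≤ M₁ * δ := mul_le_mul_of_nonneg_left (hmean_abs_apply_le φ c R z hwc k hδ0 hδ) hM₁
  have hCv_mean : |hmean φ c R z Cv| ≤ 3 * M₁ * δ := by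
    have hp0 : Continuous fun x => w x 0 * fderiv ℝ w x (EuclideanSpace.single 0 1) 2 := (hwi 0).mul (hDc _ 2)
    have hp1 : Continuous fun x => w x 1 * fderiv ℝ w x (EuclideanSpace.single 1 1) 2 := (hwi 1).mul (hDc _ 2)
    have hp2 : Continuous fun x => w x 2 * fderiv ℝ w x (EuclideanSpace.single 2 1) 2 := (hwi 2).mul (hDc _ 2)
    have hp01 : Continuous fun x => w x 0 * fderiv ℝ w x (EuclideanSpace.single 0 1) 2 +
        w x 1 * fderiv ℝ w x (EuclideanSpace.single 1 1) 2 := hp0.add hp1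
    rw [hCv, hmean_add φ c R z (F := fun x => w x 0 * fderiv ℝ w x (EuclideanSpace.single 0 1) 2 +
        w x 1 * fderiv ℝ w x (EuclideanSpace.single 1 1) 2) (G := fun x => w x 2 * fderiv ℝ w x (EuclideanSpace.single 2 1) 2) hp01 hp2,
      hmean_add φ c R z (F := fun x => w x 0 * fderiv ℝ w x (EuclideanSpace.single 0 1) 2)
        (G := fun x => w x 1 * fderiv ℝ w x (EuclideanSpace.single 1 1) 2) hp0 hp1]
    have e0 := hk 0; have e1 := hk 1; have e2 := hk 2
    calc _ ≤ |hmean φ c R z (fun x => w x 0 * fderiv ℝ w x (EuclideanSpace.single 0 1) 2)| +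
          |hmean φ c R z (fun x => w x 1 * fderiv ℝ w x (EuclideanSpace.single 1 1) 2)| +
          |hmean φ c R z (fun x => w x 2 * fderiv ℝ w x (EuclideanSpace.single 2 1) 2)| := abs_add_three _ _ _
      _ ≤ M₁ * δ + M₁ * δ + M₁ * δ := by gcongr
      _ = 3 * M₁ * δ := by ring
  -- (2) the Laplacian mean: `|⟨Lp⟩| ≤ 2 R⁻¹ M₁ β`
  have hhor : ∀ (b : Fin 2) (i : Fin 3) (e : EuclideanSpace ℝ (Fin 3)) {M : ℝ}, (∀ x, |fderiv ℝ w x e i| ≤ M) →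
      |hmean φ c R z (fun x => fderiv ℝ (fun y => fderiv ℝ w y e i) x (EuclideanSpace.single (Fin.castSucc b) 1))| ≤
        R⁻¹ * M * bumpDerivNorm φ b :=
    fun b i e M hM => abs_hmean_fderiv_horizontal_le φ c R z (contDiff_fderiv_apply hw e i) hR b hM
  have hL0 := hhor 0 2 (EuclideanSpace.single 0 1) (hDb 0 2)
  have hL1 := hhor 1 2 (EuclideanSpace.single 1 1) (hDb 1 2)
  have hV0 := hhor 0 0 (EuclideanSpace.single 2 1) (hDb 2 0)
  have hV1 := hhor 1 1 (EuclideanSpace.single 2 1) (hDb 2 1)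
  simp only [Fin.castSucc_zero, Fin.castSucc_one] at hL0 hL1 hV0 hV1
  have hvert : hmean φ c R z (fun x => fderiv ℝ (fun y => fderiv ℝ w y (EuclideanSpace.single 2 1) 2) x (EuclideanSpace.single 2 1)) =
      -hmean φ c R z (fun x => fderiv ℝ (fun y => fderiv ℝ w y (EuclideanSpace.single 2 1) 0) x (EuclideanSpace.single 0 1)) -
        hmean φ c R z (fun x => fderiv ℝ (fun y => fderiv ℝ w y (EuclideanSpace.single 2 1) 1) x (EuclideanSpace.single 1 1)) := by
    have hfun : (fun x => fderiv ℝ (fun y => fderiv ℝ w y (EuclideanSpace.single 2 1) 2) x (EuclideanSpace.single 2 1)) =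
        fun x => -(fderiv ℝ (fun y => fderiv ℝ w y (EuclideanSpace.single 2 1) 0) x (EuclideanSpace.single 0 1)) -
          fderiv ℝ (fun y => fderiv ℝ w y (EuclideanSpace.single 2 1) 1) x (EuclideanSpace.single 1 1) :=
      funext fun x => fderiv_vert_vert_eq hw hdiv x
    have hn : Continuous fun x => -(fderiv ℝ (fun y => fderiv ℝ w y (EuclideanSpace.single 2 1) 0) x (EuclideanSpace.single 0 1)) :=
      (hD2c _ _ 0).neg
    rw [hfun, hmean_sub φ c R z (F := fun x => -(fderiv ℝ (fun y => fderiv ℝ w y (EuclideanSpace.single 2 1) 0) x (EuclideanSpace.single 0 1)))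
      (G := fun x => fderiv ℝ (fun y => fderiv ℝ w y (EuclideanSpace.single 2 1) 1) x (EuclideanSpace.single 1 1)) hn (hD2c _ _ 1)]
    simp [hmean, neg_mul, integral_neg]
  have hLp_mean : |hmean φ c R z Lp| ≤ 2 * (R⁻¹ * M₁ * β) := by
    have hq0 : Continuous fun x => fderiv ℝ (fun y => fderiv ℝ w y (EuclideanSpace.single 0 1) 2) x (EuclideanSpace.single 0 1) :=
      hD2c _ _ 2
    have hq1 : Continuous fun x => fderiv ℝ (fun y => fderiv ℝ w y (EuclideanSpace.single 1 1) 2) x (EuclideanSpace.single 1 1) :=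
      hD2c _ _ 2
    have hq2 : Continuous fun x => fderiv ℝ (fun y => fderiv ℝ w y (EuclideanSpace.single 2 1) 2) x (EuclideanSpace.single 2 1) :=
      hD2c _ _ 2
    have hq01 : Continuous fun x => fderiv ℝ (fun y => fderiv ℝ w y (EuclideanSpace.single 0 1) 2) x (EuclideanSpace.single 0 1) +
        fderiv ℝ (fun y => fderiv ℝ w y (EuclideanSpace.single 1 1) 2) x (EuclideanSpace.single 1 1) := hq0.add hq1
    rw [hLp, hmean_add φ c R z (F := fun x => fderiv ℝ (fun y => fderiv ℝ w y (EuclideanSpace.single 0 1) 2) x (EuclideanSpace.single 0 1) +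
        fderiv ℝ (fun y => fderiv ℝ w y (EuclideanSpace.single 1 1) 2) x (EuclideanSpace.single 1 1))
        (G := fun x => fderiv ℝ (fun y => fderiv ℝ w y (EuclideanSpace.single 2 1) 2) x (EuclideanSpace.single 2 1)) hq01 hq2,
      hmean_add φ c R z (F := fun x => fderiv ℝ (fun y => fderiv ℝ w y (EuclideanSpace.single 0 1) 2) x (EuclideanSpace.single 0 1))
        (G := fun x => fderiv ℝ (fun y => fderiv ℝ w y (EuclideanSpace.single 1 1) 2) x (EuclideanSpace.single 1 1)) hq0 hq1, hvert]
    calc _ ≤ |hmean φ c R z (fun x => fderiv ℝ (fun y => fderiv ℝ w y (EuclideanSpace.single 0 1) 2) x (EuclideanSpace.single 0 1))| +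
          |hmean φ c R z (fun x => fderiv ℝ (fun y => fderiv ℝ w y (EuclideanSpace.single 1 1) 2) x (EuclideanSpace.single 1 1))| +
          |-hmean φ c R z (fun x => fderiv ℝ (fun y => fderiv ℝ w y (EuclideanSpace.single 2 1) 0) x (EuclideanSpace.single 0 1)) -
            hmean φ c R z (fun x => fderiv ℝ (fun y => fderiv ℝ w y (EuclideanSpace.single 2 1) 1) x (EuclideanSpace.single 1 1))| :=
          abs_add_three _ _ _
      _ ≤ R⁻¹ * M₁ * bumpDerivNorm φ 0 + R⁻¹ * M₁ * bumpDerivNorm φ 1 +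
          (R⁻¹ * M₁ * bumpDerivNorm φ 0 + R⁻¹ * M₁ * bumpDerivNorm φ 1) := by
          gcongr
          · calc _ ≤ |-hmean φ c R z (fun x => fderiv ℝ (fun y => fderiv ℝ w y (EuclideanSpace.single 2 1) 0) x
                    (EuclideanSpace.single 0 1))| +
                  |hmean φ c R z (fun x => fderiv ℝ (fun y => fderiv ℝ w y (EuclideanSpace.single 2 1) 1) x
                    (EuclideanSpace.single 1 1))| := abs_sub _ _
              _ ≤ _ := by rw [abs_neg]; exact add_le_add hV0 hV1
      _ = 2 * (R⁻¹ * M₁ * β) := by rw [hβ]; ring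
  -- (3) the vertical velocity and its square
  have hw2_mean : |hmean φ c R z (fun x => w x 2)| ≤ δ := by
    have h := abs_hmean_mul_le φ c R z (F := fun _ => (1 : ℝ)) (G := fun x => w x 2) continuous_const (hwi 2)
      (M := 1) (fun _ => by simp)
    simp only [mul_one, one_mul] at h
    exact h.trans (hmean_abs_apply_le φ c R z hwc 2 hδ0 hδ)
  have hw2sq_mean : |hmean φ c R z (fun x => w x 2 ^ 2)| ≤ δ ^ 2 := by
    rw [abs_of_nonneg (hmean_nonneg φ c R z fun x => sq_nonneg _)]
    have hcn : Continuous fun x => ‖w x‖ ^ 2 := (hwc.norm).pow 2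
    refine le_trans (hmean_mono φ c R z hc_w2sq hcn fun x => ?_) hδ
    show w x 2 ^ 2 ≤ ‖w x‖ ^ 2
    rw [EuclideanSpace.real_norm_sq_eq]
    exact Finset.single_le_sum (f := fun i => w x i ^ 2) (fun i _ => sq_nonneg _) (Finset.mem_univ 2)
  -- (4) the vertical strain `∂₂w₂ = −∂₀w₀ − ∂₁w₁`
  have hhor1 : ∀ (b : Fin 2) (i : Fin 3),
      |hmean φ c R z (fun x => fderiv ℝ (fun y => w y i) x (EuclideanSpace.single (Fin.castSucc b) 1))| ≤ R⁻¹ * M₀ * bumpDerivNorm φ b :=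
    fun b i => abs_hmean_fderiv_horizontal_le φ c R z
      ((EuclideanSpace.proj i : EuclideanSpace ℝ (Fin 3) →L[ℝ] ℝ).contDiff.comp (hw.of_le (by norm_num))) hR b (hwb i)
  have hS0 := hhor1 0 0
  have hS1 := hhor1 1 1
  simp only [Fin.castSucc_zero, Fin.castSucc_one] at hS0 hS1
  have hstrain : |hmean φ c R z (fun x => fderiv ℝ w x (EuclideanSpace.single 2 1) 2)| ≤ R⁻¹ * M₀ * β := by
    have hfun : (fun x => fderiv ℝ w x (EuclideanSpace.single 2 1) 2) =
        fun x => -(fderiv ℝ (fun y => w y 0) x (EuclideanSpace.single 0 1)) - fderiv ℝ (fun y => w y 1) x (EuclideanSpace.single 1 1) := by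
      funext x; rw [fderiv_apply_comp hwd, fderiv_apply_comp hwd]; linarith [hdiv x]
    have hc0 : Continuous fun x => fderiv ℝ (fun y => w y 0) x (EuclideanSpace.single 0 1) := by
      have := hDc (EuclideanSpace.single 0 1) 0
      refine this.congr fun x => ?_; rw [fderiv_apply_comp hwd]
    have hc1 : Continuous fun x => fderiv ℝ (fun y => w y 1) x (EuclideanSpace.single 1 1) := by
      have := hDc (EuclideanSpace.single 1 1) 1
      refine this.congr fun x => ?_; rw [fderiv_apply_comp hwd]
    have hc0n : Continuous fun x => -(fderiv ℝ (fun y => w y 0) x (EuclideanSpace.single 0 1)) := hc0.neg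
    rw [hfun, hmean_sub φ c R z (F := fun x => -(fderiv ℝ (fun y => w y 0) x (EuclideanSpace.single 0 1)))
      (G := fun x => fderiv ℝ (fun y => w y 1) x (EuclideanSpace.single 1 1)) hc0n hc1]
    have hneg : hmean φ c R z (fun x => -fderiv ℝ (fun y => w y 0) x (EuclideanSpace.single 0 1)) =
        -hmean φ c R z (fun x => fderiv ℝ (fun y => w y 0) x (EuclideanSpace.single 0 1)) := by
      simp [hmean, neg_mul, integral_neg]
    rw [hneg]
    calc _ ≤ |-hmean φ c R z (fun x => fderiv ℝ (fun y => w y 0) x (EuclideanSpace.single 0 1))| +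
          |hmean φ c R z (fun x => fderiv ℝ (fun y => w y 1) x (EuclideanSpace.single 1 1))| := abs_sub _ _
      _ ≤ R⁻¹ * M₀ * bumpDerivNorm φ 0 + R⁻¹ * M₀ * bumpDerivNorm φ 1 := by rw [abs_neg]; exact add_le_add hS0 hS1
      _ = R⁻¹ * M₀ * β := by rw [hβ]; ring
  -- assemble
  rw [hsplit, hRest_mean]
  have hRi : 0 ≤ R⁻¹ := inv_nonneg.2 hR.le
  calc |(1 - m₀) * hmean φ c R z Cv - (1 - m₀) * hmean φ c R z Lp - (mt - mzz) * hmean φ c R z (fun x => w x 2)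
        - mz / 2 * hmean φ c R z (fun x => w x 2 ^ 2) + 2 * mz * hmean φ c R z (fun x => fderiv ℝ w x (EuclideanSpace.single 2 1) 2)|
      ≤ |(1 - m₀) * hmean φ c R z Cv| + |(1 - m₀) * hmean φ c R z Lp| + |(mt - mzz) * hmean φ c R z (fun x => w x 2)|
        + |mz / 2 * hmean φ c R z (fun x => w x 2 ^ 2)| + |2 * mz * hmean φ c R z (fun x => fderiv ℝ w x (EuclideanSpace.single 2 1) 2)| := by
        have t1 := abs_sub ((1 - m₀) * hmean φ c R z Cv - (1 - m₀) * hmean φ c R z Lp - (mt - mzz) * hmean φ c R z (fun x => w x 2)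
          - mz / 2 * hmean φ c R z (fun x => w x 2 ^ 2)) (-(2 * mz * hmean φ c R z (fun x => fderiv ℝ w x (EuclideanSpace.single 2 1) 2)))
        have t2 := abs_sub ((1 - m₀) * hmean φ c R z Cv - (1 - m₀) * hmean φ c R z Lp - (mt - mzz) * hmean φ c R z (fun x => w x 2))
          (mz / 2 * hmean φ c R z (fun x => w x 2 ^ 2))
        have t3 := abs_sub ((1 - m₀) * hmean φ c R z Cv - (1 - m₀) * hmean φ c R z Lp) ((mt - mzz) * hmean φ c R z (fun x => w x 2))
        have t4 := abs_sub ((1 - m₀) * hmean φ c R z Cv) ((1 - m₀) * hmean φ c R z Lp)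
        rw [sub_neg_eq_add, abs_neg] at t1
        linarith
    _ ≤ |1 - m₀| * (3 * M₁ * δ) + |1 - m₀| * (2 * (R⁻¹ * M₁ * β)) + (|mt| + |mzz|) * δ + |mz| / 2 * δ ^ 2
        + 2 * |mz| * (R⁻¹ * M₀ * β) := by
        rw [abs_mul, abs_mul, abs_mul, abs_mul, abs_mul, abs_div, abs_two, abs_mul, abs_two]
        have a1 := mul_le_mul_of_nonneg_left hCv_mean (abs_nonneg (1 - m₀))
        have a2 := mul_le_mul_of_nonneg_left hLp_mean (abs_nonneg (1 - m₀))
        have a3 : |mt - mzz| * |hmean φ c R z (fun x => w x 2)| ≤ (|mt| + |mzz|) * δ :=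
          mul_le_mul (abs_sub _ _) hw2_mean (abs_nonneg _) (by positivity)
        have a4 := mul_le_mul_of_nonneg_left hw2sq_mean (div_nonneg (abs_nonneg mz) zero_le_two)
        have a5 := mul_le_mul_of_nonneg_left hstrain (mul_nonneg zero_le_two (abs_nonneg mz))
        linarith
    _ = _ := by ring

end Summit.NavierStokesRegularity.NavierStokesRegularity.Theorems.PoloidalWindowDoorPoloidalWindowRigiditySparseEnergyPlaneLaw

end
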